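import Literature.NumberTheory.Automorphic.UnitaryGroupOddLineMover
import Literature.NumberTheory.Automorphic.UnitaryGroupIsotropicRootDuality
import Literature.NumberTheory.Automorphic.UnitaryGroupIntegralRootData
import Literature.RepresentationTheory.HeisenbergGroup.EigenvectorSiegelTransport
import Literature.RepresentationTheory.HeisenbergGroup.SchwartzBruhatLatticeUncertaintyBox
import Literature.RepresentationTheory.HeisenbergGroup.QuadricVanishingOfRootFamilies
import Literature.NumberTheory.QuadraticForms.UnramifiedBinaryNormValuation
import HarnessLib

/-!
# (CORE′) No integral eigenvector of the local Weil representation on a hermitian space of ODD line class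
# (road δ of the cell `hodgecm-mathlib`: NSI-core′ in house, by an INTEGRAL UNCERTAINTY PRINCIPLE — splitting-free)

Topic `NumberTheory/Automorphic`; namespace `Literature.NumberTheory.Automorphic.UnitaryGroup`.  ONE THEOREM (kernel lane; no definition,
no named fact, no `sorry`): **`eq_zero_of_forall_implementer_eigen_of_odd`** — at a good inert place `v` (`|2|_v = |d|_v = 1`,
`E ⊗ F_v` a field, `ψ_v` of conductor `𝒪_v`), for a DIAGONAL hermitian form `T = diagonal tD` all of whose entries have the same
valuation `m` with `m` ODD and `N ≥ 2` (two indices `i₁ ≠ i₂`), no non-zero `f ∈ 𝒮(F_vᴺ)` is a common eigenvector of all implementers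
of `ι_v(k)`, `k ∈ U(J)(𝒪_v)`, on the Schrödinger model (the statement of record `CORE-PRIME-statement.F0P2-plan-g5.lean`, VERBATIM).
Since the local Weil representation `ω_v(k) = s_v(k)` of ANY splitting `s_v` over `ι_v` is such an implementer, `(ω_v)^{U(J)(𝒪_v)} = 0`:
this is «the theta lift of the unramified character to the ODD hermitian line is not spherical» = «πˢ has no hyperspecial vector»
([GelbartRogawski1991, p. 467]; [Rogawski1990, Prop. 13.1.3 (d)]; [HarrisKudlaSweet1996, Thm 6.1]) — proved here WITHOUT the
Jacquet filtration and without evaluating any splitting.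

PROOF (road δ): δ2-A ★ `exists_integralRootData` (an integral hyperbolic pair `(r, r′)` of `h`, its integral root elements
`n_{bδ}(r)` for `b ∈ 𝔭^{−m}`, `n_{bδ}(r′)` for `b ∈ 𝔭^{m}`, its integral Levi dilations, and a unit `α` with `N(α) − 1` a unit) ∘ δ2-M ★
`exists_mover_integralHyperbolicPair` (mover `g₀`, identities (C1)–(C3)) ∘ δ2-T ★ `EigenvectorSiegelTransport` (the transported
`f′ = M₀ f` is an eigenvector of the multiplications `ψ(t·Q)`, `Q = −½(ξ₀² − dξ₁²)`, `t ∈ 𝔭^{−m}`; of the unit dilation by `Res(β)`; and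
`(𝓕_{x′} ⊠ 1)⁻¹ f′` of `ψ(t·Q₂)`, `Q₂ = −½(ξ₁² − dξ₀²)`, `t ∈ 𝔭^{m}`) ∘ δ1 ★ `SchwartzBruhatLatticeUncertainty(Box)` +
★ `UnramifiedBinaryNormValuation`: the `x′`-support of `f′` lies in `(𝔭^{a+1})²` (`m = 2a+1`; support feeder + dilation with
`|N(β) − 1| = 1` + the sharp unramified norm law), its partial Fourier transform is `(𝔭^{−a−1})²`-periodic and `ψ(b ϖ^{m}(−½)Q₂)`-eigen,
and the parity `−m + 2(a+1) = 1` is exactly the lattice obstruction ⇒ `f′ = 0` ⇒ `f = 0`.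

Cell `hodgecm-mathlib`, fan F0∕P2, crux H413 = stmt-HodgeConjecture-24833, director s484; crew F0P2-p01 (g4) (lead, δ2), B-p10 (g17)
(δ1), B-p17 (g17) (δ2-T, δ2-A), B-p18 (g24) (δ3), F0P2-plan (g5) (statement), F0P2-ref1 (g2) (boxes).  HC_CM is proved only modulo
the printed citations until rung 0 closes; this file discharges no printed citation by itself (NSI closes BY NAME in δ3).

## References
* [GelbartRogawski1991] S. Gelbart, J. Rogawski, Invent. Math. 105 (1991), Lem. 5.1.2 p. 466, p. 467, §1.4 p. 451.
* [Rogawski1990] J. Rogawski, Ann. of Math. Stud. 123 (1990), Prop. 13.1.3 (d), §12.2.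
* [HarrisKudlaSweet1996] M. Harris, S. Kudla, W. J. Sweet, J. AMS 9 (1996), Thm. 6.1, Cor. 8.3.
* [MoeglinVignerasWaldspurger1987] C. Mœglin, M.-F. Vignéras, J.-L. Waldspurger, LNM 1291 (1987), Chap. 2 II.1 (A), II.6, II.10.
* [WeilBNT1967] A. Weil, *Basic Number Theory* (1967), Chap. VII §2 Prop. 2.
-/

set_option autoImplicit false

noncomputable section

open NumberField IsDedekindDomain Matrix
open scoped NNReal
open Literature.RepresentationTheory Literature.RepresentationTheory.HeisenbergGroup
open Literature.NumberTheory.Automorphic Literature.NumberTheory.Automorphic.UnitaryGroup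
open Literature.NumberTheory.GaloisRepresentations.IsNonarchimedeanLocalField
open Literature.NumberTheory.GelbartRogawski1991.UnitaryDualPair.LocalSplitting

namespace Literature.NumberTheory.Automorphic.UnitaryGroup

/-! ## §3 THE HEAD (CORE′): no integral eigenvector on an odd line -/

section Head

variable {F : Type} [Field F] [NumberField F] (E : Type) [Field E] [NumberField E] [Algebra F E]
  [Algebra.IsQuadraticExtension F E] (c : E ≃ₐ[F] E) (N : ℕ) (J : Matrix (Fin N) (Fin N) E)
  (v : HeightOneSpectrum (𝓞 F)) {δ : E} (hcδ : c δ = -δ) (hδ : δ ≠ 0) {d : F} (hd : δ * δ = algebraMap F E d)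

set_option maxHeartbeats 2000000 in
/-- **(CORE′) — at a good inert place, a diagonal hermitian line of ODD valuation class carries no non-zero common eigenvector of
the integral implementers.**  `v ∤ 2`, `E ⊗ F_v` a field, `d = δ²` a `v`-unit, `ψ_v` of conductor `𝒪_v`, `J = diag(tD)` with every
`|tD i|_v = q_v^{-m}`, `m` ODD, two indices `i₁ ≠ i₂`: if `f ∈ 𝒮(F_vᴺ)` is an eigenvector of EVERY implementer of `ι_v(k)` for every
`k ∈ U(J)(𝒪_v)`, then `f = 0`.  Splitting-free: for any local splitting `s_v` over `ι_v`, `ω_v(k) = s_v(k)` IS such an implementer, so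
`(ω_v)^{U(J)(𝒪_v)} = 0`.  PROOF = the integral uncertainty principle: δ2-A (★ `exists_integralRootData`: an integral hyperbolic pair
with its integral root elements `n_{bδ}(r)`, `b ∈ 𝔭^{−m}`, `n_{bδ}(r′)`, `b ∈ 𝔭^{m}`, and Levi dilations) ∘ the mover
(`exists_mover_integralHyperbolicPair`) ∘ δ2-T (★ `EigenvectorSiegelTransport`: the transported `f′ = M₀ f` is an eigenvector of the
multiplications `ψ(b·Q)`, of the `𝓕_{x′} ⊠ 1`-conjugate multiplications `ψ(b·Q₂)` and of the unit dilations) ∘ δ1 (★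
`SchwartzBruhatLatticeUncertainty(Box)`: `x′`-support in `(𝔭^a)²`, `a = (m+1)/2`, by the unramified binary norm law ★
`UnramifiedBinaryNormValuation`; partial Fourier side periodic and `ψ(b ϖ^{m} N)`-eigen; parity `−m + 2a = 1` ⇒ `f′ = 0`).
[print: none — GelbartRogawski1991 p. 467 ∕ HarrisKudlaSweet1996 Thm 6.1 reach «πˢ has no hyperspecial vector» through the Jacquet filtration]
[cite: MoeglinVignerasWaldspurger1987, Chap. 2 II.6, Chap. 3 §IV.2] [cite: Weil1964, n° 13] [cite: WeilBNT1967, Chap. VII §2 Prop. 2] -/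
theorem eq_zero_of_forall_implementer_eigen_of_odd (T : Matrix (Fin N) (Fin N) F) (hT : T.IsSymm)
    (hJ : J = T.map (algebraMap F E)) (tD : Fin N → F) (hTD : T = Matrix.diagonal tD) (i₁ i₂ : Fin N) (hi : i₁ ≠ i₂)
    (hE : IsField (LocalRing E v)) (h2 : normAbs (v.adicCompletion F) (2 : v.adicCompletion F) = 1)
    (hdv : normAbs (v.adicCompletion F) (algebraMap F (v.adicCompletion F) d) = 1) (hψ : (adeleAddCharAt F v).HasConductorExp 0)
    (m : ℤ) (hm : ∀ i, normAbs (v.adicCompletion F) (algebraMap F (v.adicCompletion F) (tD i)) =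
      ((residueFieldCard (v.adicCompletion F) : ℝ≥0)⁻¹) ^ m) (hodd : Odd m)
    (f : SchwartzBruhat (Fin N → v.adicCompletion F))
    (hf : ∀ k ∈ localInt E c N J v, ∀ M : SchwartzBruhat (Fin N → v.adicCompletion F) ≃ₗ[ℂ] SchwartzBruhat (Fin N → v.adicCompletion F),
      (iota F E c N hcδ hδ hd T hT hJ v k, M) ∈ MpPsi (localSchrodinger F N T v) → ∃ a : ℂ, M f = a • f) :
    f = 0 := by
  classical
  obtain ⟨a, ha⟩ := hodd
  -- ### basic facts
  haveI : CharZero (v.adicCompletion F) := charZero_of_injective_algebraMap (algebraMap F (v.adicCompletion F)).injective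
  have hq := isQuadraticCoordinates_local E v c hcδ hδ hd
  have hJh : (J.map c)ᵀ = J := by
    rw [hJ, Matrix.map_map]
    have h : (⇑c ∘ ⇑(algebraMap F E)) = ⇑(algebraMap F E) := funext fun t => c.commutes t
    rw [h, ← Matrix.transpose_map, hT.eq]
  have htD0 : ∀ i, tD i ≠ 0 := fun i h0 => by
    have := hm i
    rw [h0, map_zero, map_zero] at this
    exact (zpow_ne_zero m inv_residueFieldCard_pos.ne') this.symm
  have hTd : IsUnit T.det := by
    rw [hTD, Matrix.det_diagonal]; exact IsUnit.mk0 _ (Finset.prod_ne_zero_iff.2 fun i _ => htD0 i)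
  have hAd : IsUnit (localGram F N T v).det := UnitaryGroup.isUnit_det_map (algebraMap F (v.adicCompletion F)) hTd
  -- `d` is not a square in `F_v` (the place is inert)
  have hnsq : ¬ IsSquare (d : v.adicCompletion F) := by
    rintro ⟨s, hs⟩
    have hzero : conjLocal E c v (toLocalRing E v s - algebraMap E (LocalRing E v) δ) *
        (toLocalRing E v s - algebraMap E (LocalRing E v) δ) = 0 := by
      rw [map_sub, conjLocal_toLocalRing, conjLocal_algebraMap, hcδ, map_neg, sub_neg_eq_add]
      have : (toLocalRing E v s + algebraMap E (LocalRing E v) δ) * (toLocalRing E v s - algebraMap E (LocalRing E v) δ) =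
          toLocalRing E v s * toLocalRing E v s - algebraMap E (LocalRing E v) δ * algebraMap E (LocalRing E v) δ := by ring
      rw [this, hq.mul_self, ← map_mul, ← hs, sub_self]
    have h0 := eq_zero_of_conjLocal_mul_self_eq_zero E c v hE hzero
    have := congrArg (QuadraticCoordinates.im (quadraticLocalEquiv E v c hcδ hδ).toLinearEquiv.toAddEquiv) h0
    rw [map_sub, hq.im_map, hq.im_delta, map_zero] at this
    norm_num at this
  -- ### the pair block `e' : Fin 2 ⊕ ι₂ ≃ Fin N`
  let pp : Fin N → Prop := fun k => k = i₁ ∨ k = i₂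
  let e₂ : Fin 2 ≃ {k // pp k} :=
    { toFun := fun j => if j = 0 then ⟨i₁, Or.inl rfl⟩ else ⟨i₂, Or.inr rfl⟩
      invFun := fun k => if (k : Fin N) = i₁ then 0 else 1
      left_inv := fun j => by
        fin_cases j
        · simp
        · simp [hi.symm]
      right_inv := fun k => by
        rcases k with ⟨k, hk | hk⟩
        · subst hk; simp
        · subst hk; simp [hi.symm] }
  let e' : Fin 2 ⊕ {k // ¬ pp k} ≃ Fin N := (e₂.sumCongr (Equiv.refl _)).trans (Equiv.sumCompl pp)
  have he'inr : ∀ j : {k // ¬ pp k}, e' (Sum.inr j) = j.1 := fun j => by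
    simp [e', Equiv.sumCompl_apply_inr]
  -- ### δ2-A: the integral root data
  obtain ⟨r, r', hr, hr', hrr', hsupp, hKr, hKr', hKD, α, β, n, hαi, hβi, hσαβ, hαn, hn⟩ :=
    exists_integralRootData E c N J v hcδ hδ hd T hT hJ hJh tD hTD i₁ i₂ hi hE h2 hdv m hm
  have hsupp' : ∀ j : {k // ¬ pp k}, r (e' (Sum.inr j)) = 0 ∧ r' (e' (Sum.inr j)) = 0 := fun j => by
    rw [he'inr]; exact hsupp j.1 (fun h => j.2 (Or.inl h)) (fun h => j.2 (Or.inr h))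
  -- ### the mover and the three conjugation identities
  obtain ⟨g₀, c₀, c₀', hc₀, hc₀', hQ₀, hQ₀', hC1, hC2, hC3⟩ :=
    exists_mover_integralHyperbolicPair E c N J v hcδ hδ hd T hT hJ hJh tD hTD htD0 e' hr hr' hrr' hsupp'
  -- ### the Schrödinger model, its implementers, the mover pair `q = (g₀, M₀)`
  have hψc := isContinuousNontrivial_adeleAddCharAt F v
  have hl : IsLocallyConstant (⇑(adeleAddCharAt F v) : v.adicCompletion F → Circle) :=
    isLocallyConstant_of_isContinuousNontrivial hψc
  have hb : ∀ y : Fin N → v.adicCompletion F, Continuous fun u : Fin N → v.adicCompletion F => localPairing F N T v u y :=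
    continuous_toLinearMap₂'_left' (K := v.adicCompletion F) (localGram F N T v)
  have hU : ImplementerUniqueUpToScalar (schrodingerSB (localPairing F N T v) (adeleAddCharAt F v) hl hb) :=
    implementerUniqueUpToScalar_localSchrodinger F N T hTd v
  have hexI : ∀ g : LocalSp F N T v, ∃ P : MpPsi (schrodingerSB (localPairing F N T v) (adeleAddCharAt F v) hl hb),
      MpPsi.proj _ P = g := fun g => by
    obtain ⟨M, hM⟩ := existsImplementer_localSchrodinger F N T hTd v g
    exact ⟨⟨(g, M), hM⟩, rfl⟩
  choose P hP using hexI
  obtain ⟨M₀, hM₀⟩ := existsImplementer_localSchrodinger F N T hTd v g₀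
  let q : MpPsi (schrodingerSB (localPairing F N T v) (adeleAddCharAt F v) hl hb) := ⟨(g₀, M₀), hM₀⟩
  have hqproj : MpPsi.proj _ q = g₀ := rfl
  -- the hypothesis on `f` read on the chosen implementers of integral elements
  have hPf : ∀ k ∈ localInt E c N J v, ∃ κ : ℂ,
      MpPsi.toOp _ (P (iota F E c N hcδ hδ hd T hT hJ v k)) f = κ • f := by
    intro k hk
    refine hf k hk _ ?_
    have h2' := (P (iota F E c N hcδ hδ hd T hT hJ v k)).2
    have h1 : (P (iota F E c N hcδ hδ hd T hT hJ v k)).1.1 = iota F E c N hcδ hδ hd T hT hJ v k := by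
      have := hP (iota F E c N hcδ hδ hd T hT hJ v k)
      rwa [MpPsi.proj_apply] at this
    have heq : (P (iota F E c N hcδ hδ hd T hT hJ v k)).1 =
        (iota F E c N hcδ hδ hd T hT hJ v k, MpPsi.toOp _ (P (iota F E c N hcδ hδ hd T hT hJ v k))) :=
      Prod.ext h1 (MpPsi.toOp_apply _ _).symm
    rw [heq] at h2'
    exact h2'
  -- continuity of the second-degree data
  have hqc : ∀ t : v.adicCompletion F, Continuous fun x : Fin N → v.adicCompletion F =>
      ⅟(2 : v.adicCompletion F) * localPairing F N T v x ((t • c₀) x) :=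
    continuous_half_localPairing_smul_apply F v N T c₀
  have hqc' : ∀ t : v.adicCompletion F, Continuous fun x : Fin N → v.adicCompletion F =>
      ⅟(2 : v.adicCompletion F) * localPairing F N T v x ((t • c₀') x) :=
    continuous_half_localPairing_smul_apply F v N T c₀'
  set f' : SchwartzBruhat (Fin N → v.adicCompletion F) := MpPsi.toOp _ q f with hf'
  -- scalars of absolute value `q^{m}` and `q^{−m}`, and `|⅟2| = 1`
  obtain ⟨cM, -, hcM⟩ := exists_normAbs_eq_inv_zpow_of_int (F := v.adicCompletion F) (-m)
  obtain ⟨cm, -, hcm⟩ := exists_normAbs_eq_inv_zpow_of_int (F := v.adicCompletion F) m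
  have hhalf : normAbs (v.adicCompletion F) (-(⅟(2 : v.adicCompletion F))) = 1 := by
    rw [normAbs_neg]
    have h := congrArg (normAbs (v.adicCompletion F)) (invOf_mul_self (2 : v.adicCompletion F))
    rw [map_mul, h2, mul_one, map_one] at h
    exact h
  have hhalf0 : normAbs (v.adicCompletion F) (-(⅟(2 : v.adicCompletion F))) =
      ((residueFieldCard (v.adicCompletion F) : ℝ≥0)⁻¹) ^ (0 : ℤ) := by rw [zpow_zero, hhalf]
  -- ### (1) the multiplication side: `f′` is an eigenvector of `ψ(b · Q₁)`, `Q₁ = cM · (−½ N⁰)`, for `b ∈ 𝒪`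
  have hE1 : ∀ b ∈ primePowBall (v.adicCompletion F) 0, ∃ l : ℂ, ∀ y : Fin N → v.adicCompletion F,
      ((adeleAddCharAt F v (b * (cM * (-(⅟(2 : v.adicCompletion F)) *
          ((resL e' y 0) ^ 2 - (d : v.adicCompletion F) * (resL e' y 1) ^ 2)))) : Circle) : ℂ) * (f' : _ → ℂ) y =
        l * (f' : _ → ℂ) y := by
    intro b hb0
    have ht : cM * b ∈ primePowBall (v.adicCompletion F) (-m) := by
      rw [mul_mem_primePowBall_iff hcM, sub_self]; exact hb0
    obtain ⟨κ, hκ⟩ := hPf _ (hKr _ ht)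
    obtain ⟨κ', hκ'⟩ := eigenvector_of_conj_unipotentSp_apply (localPairing F N T v) (adeleAddCharAt F v) hl hb hU q
      (P _) ((cM * b) • c₀) (symm_smul_of_symm (localPairing F N T v) c₀ hc₀ (cM * b)) (hqc (cM * b))
      (by rw [hqproj, hP]; exact hC1 (cM * b)) f κ hκ
    refine ⟨κ', fun y => ?_⟩
    have key : b * (cM * (-(⅟(2 : v.adicCompletion F)) * ((resL e' y 0) ^ 2 - (d : v.adicCompletion F) * (resL e' y 1) ^ 2))) =
        -(⅟(2 : v.adicCompletion F) * localPairing F N T v y (((cM * b) • c₀) y)) := by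
      rw [LinearMap.smul_apply, map_smul, smul_eq_mul, hQ₀]; ring
    rw [key, mul_comm]
    exact hκ' y
  -- ### (2) the torus: the support of `f′` is stable under the dilation `a⁻¹` of an integral Levi element with `ν − 1` a unit
  have hσσ : ∀ z : LocalRing E v, conjLocal E c v (conjLocal E c v z) = z :=
    Liu2021.LemD1OfPlace.conjLocal_conjLocal_apply E v c hcδ hδ
  have hHh := Liu2021.LemD1OfPlace.localGram_hermitian E v c N J hJh
  have hr'r := hermForm_localGram_partner_symm E c N J v hcδ hδ hJh hrr'
  have hβα : β * conjLocal E c v α = 1 := by rw [mul_comm]; exact hσαβ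
  have hαβ' : α * conjLocal E c v β = 1 := by
    have := congrArg (conjLocal E c v) hσαβ
    rwa [map_mul, hσσ, map_one] at this
  let αu : (LocalRing E v)ˣ := Units.mkOfMulEqOne α (conjLocal E c v β) hαβ'
  let βu : (LocalRing E v)ˣ := Units.mkOfMulEqOne β (conjLocal E c v α) hβα
  let gD : «local» E c N J v :=
    ⟨lineDilationGL (conjLocal E c v) _ hr hr' hrr' hr'r αu βu,
      lineDilationGL_mem (conjLocal E c v) _ hσσ hHh hr hr' hrr' hr'r (α := αu) (β := βu) hσαβ⟩
  have hgD : (gD : GL (Fin N) (LocalRing E v)).val =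
      lineDilation (conjLocal E c v) ((adelicForm E N J).map (adeleToLocal E v)) r r' α β := rfl
  set kD := (localPiEquiv E c N J v).symm gD with hkD
  have hkDint : kD ∈ localInt E c N J v := hKD α β hαi hβi gD hgD
  have hkDval : ((localPiEquiv E c N J v kD : «local» E c N J v) : GL (Fin N) (LocalRing E v)).val =
      lineDilation (conjLocal E c v) ((adelicForm E N J).map (adeleToLocal E v)) r r' α β := by
    rw [hkD, ContinuousMulEquiv.apply_symm_apply]; exact hgD
  obtain ⟨aL, dY, had, hlevi, haL⟩ := hC3 α β hσαβ kD hkDval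
  obtain ⟨κD, hκD⟩ := hPf kD hkDint
  obtain ⟨κ', hκ'⟩ := eigenvector_of_conj_levi_apply (localPairing F N T v) (adeleAddCharAt F v) hl hb hU q (P _) aL dY had
    aL.toLinearMap.continuous_on_pi aL.symm.toLinearMap.continuous_on_pi (by rw [hqproj, hP]; exact hlevi) f κD hκD
  -- if `κ' = 0` the function `f′` vanishes outright
  by_cases hκ0 : κ' = 0
  · have hf'0 : f' = 0 := by
      apply Subtype.ext; funext x
      have := hκ' (aL x)
      rw [hκ0, zero_mul, LinearEquiv.symm_apply_apply] at this
      exact this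
    have : (MpPsi.toOp _ q) f = 0 := hf'0
    exact (map_eq_zero_iff _ (MpPsi.toOp _ q).injective).1 this
  -- the norm form and its multiplicativity along the dilation
  have hresL_aL : ∀ x, resL e' (aL x) =
      QuadraticCoordinates.mulMatrixFun (quadraticLocalEquiv E v c hcδ hδ).toLinearEquiv.toAddEquiv (d : v.adicCompletion F) β *ᵥ
        resL e' x := fun x => by rw [haL, resL_glue]
  have hN_aL : ∀ x, (resL e' (aL x) 0) ^ 2 - (d : v.adicCompletion F) * (resL e' (aL x) 1) ^ 2 =
      ((QuadraticCoordinates.re (quadraticLocalEquiv E v c hcδ hδ).toLinearEquiv.toAddEquiv β) ^ 2 -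
        (d : v.adicCompletion F) * (QuadraticCoordinates.im (quadraticLocalEquiv E v c hcδ hδ).toLinearEquiv.toAddEquiv β) ^ 2) *
        ((resL e' x 0) ^ 2 - (d : v.adicCompletion F) * (resL e' x 1) ^ 2) := by
    intro x
    rw [hresL_aL]
    simp only [Matrix.mulVec, dotProduct, Fin.sum_univ_two, QuadraticCoordinates.mulMatrixFun_apply_zero_zero,
      QuadraticCoordinates.mulMatrixFun_apply_zero_one, QuadraticCoordinates.mulMatrixFun_apply_one_zero,
      QuadraticCoordinates.mulMatrixFun_apply_one_one]
    ring
  -- `N(β) = N(α)⁻¹ = n⁻¹`-type bookkeeping: we use `ν := N(β)` with `Q₁(a x) = ν Q₁ x` and `φ := aL`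
  set ν : v.adicCompletion F :=
    (QuadraticCoordinates.re (quadraticLocalEquiv E v c hcδ hδ).toLinearEquiv.toAddEquiv β) ^ 2 -
      (d : v.adicCompletion F) * (QuadraticCoordinates.im (quadraticLocalEquiv E v c hcδ hδ).toLinearEquiv.toAddEquiv β) ^ 2 with hν
  have hνn : ν * n = 1 := by
    -- `σβ β = φ ν`, `α σα = φ n`, and `(σα β)(α σβ) = 1`
    have h1 : conjLocal E c v β * β = toLocalRing E v ν := by rw [hν]; exact conjLocal_mul_self E c hcδ hδ hd v β
    have h3 : toLocalRing E v (ν * n) = toLocalRing E v 1 := by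
      rw [map_mul, ← h1, ← hαn, map_one]
      calc conjLocal E c v β * β * (α * conjLocal E c v α)
          = (conjLocal E c v α * β) * (α * conjLocal E c v β) := by ring
        _ = 1 := by rw [hσαβ, hαβ', one_mul]
    have hinj : Function.Injective (toLocalRing E v) := fun x y hxy => by
      have := congrArg (QuadraticCoordinates.re (quadraticLocalEquiv E v c hcδ hδ).toLinearEquiv.toAddEquiv) hxy
      rwa [hq.re_map, hq.re_map] at this
    exact hinj h3
  have hνunit : normAbs (v.adicCompletion F) (ν - 1) = 1 := by
    have hσββ : conjLocal E c v β * β = toLocalRing E v ν := by rw [hν]; exact conjLocal_mul_self E c hcδ hδ hd v β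
    have hnle : normAbs (v.adicCompletion F) n ≤ 1 := by
      have hi : IsIntegralLoc F E v (toLocalRing E v n) := by rw [← hαn]; exact hαi.mul (hαi.conj (c := c))
      have := (isIntegralLoc_toLocalRing_iff F E v n).1 hi
      exact (mem_primePowBall_iff.1 ((mem_primePowBall_zero_iff_valued (F := F) (v := v) n).2 this)).trans (le_of_eq (zpow_zero _))
    have hνle : normAbs (v.adicCompletion F) ν ≤ 1 := by
      have hi : IsIntegralLoc F E v (toLocalRing E v ν) := by rw [← hσββ]; exact (hβi.conj (c := c)).mul hβi
      have := (isIntegralLoc_toLocalRing_iff F E v ν).1 hi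
      exact (mem_primePowBall_iff.1 ((mem_primePowBall_zero_iff_valued (F := F) (v := v) ν).2 this)).trans (le_of_eq (zpow_zero _))
    have hprod : normAbs (v.adicCompletion F) ν * normAbs (v.adicCompletion F) n = 1 := by rw [← map_mul, hνn, map_one]
    have hνabs : normAbs (v.adicCompletion F) ν = 1 := by
      refine le_antisymm hνle (le_of_not_gt fun hlt => ?_)
      have : normAbs (v.adicCompletion F) ν * normAbs (v.adicCompletion F) n < 1 :=
        mul_lt_one_of_nonneg_of_lt_one_left bot_le hlt hnle
      exact absurd hprod this.ne
    have hfac : ν - 1 = ν * -(n - 1) := by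
      have : ν * n = 1 := hνn
      linear_combination this
    rw [hfac, map_mul, normAbs_neg, hνabs, hn, one_mul]
  have hQφ : ∀ y : Fin N → v.adicCompletion F,
      cM * (-(⅟(2 : v.adicCompletion F)) * ((resL e' (aL y) 0) ^ 2 - (d : v.adicCompletion F) * (resL e' (aL y) 1) ^ 2)) =
        ν * (cM * (-(⅟(2 : v.adicCompletion F)) * ((resL e' y 0) ^ 2 - (d : v.adicCompletion F) * (resL e' y 1) ^ 2))) := by
    intro y; rw [hN_aL]; ring
  have hφ : ∀ y : Fin N → v.adicCompletion F, (f' : _ → ℂ) y ≠ 0 → (f' : _ → ℂ) (aL y) ≠ 0 := by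
    intro y hy h0
    have := hκ' (aL y)
    rw [LinearEquiv.symm_apply_apply, h0, mul_zero] at this
    exact hy this
  -- ### (3) the `x′`-support of `f′` lies in `(𝔭^a)²`
  have hS : ∀ x, (f' : _ → ℂ) x ≠ 0 → resL e' x ∈ piPrimePowBall (v.adicCompletion F) (Fin 2) (a + 1) := by
    intro x hx
    have hQ1 := forall_mem_primePowBall_of_mulChar_eigen_of_stable (ψ := adeleAddCharAt F v) hψ (f' : _ → ℂ)
      (fun y => cM * (-(⅟(2 : v.adicCompletion F)) * ((resL e' y 0) ^ 2 - (d : v.adicCompletion F) * (resL e' y 1) ^ 2)))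
      hE1 aL hφ hQφ hνunit x hx
    -- peel off the unit scalars: `N⁰(x|₁) ∈ 𝔭^{m} = 𝔭^{2a − 1}`
    rw [mul_mem_primePowBall_iff hcM, mul_mem_primePowBall_iff hhalf0, sub_zero] at hQ1
    have hQ1' : (resL e' x 0) ^ 2 - (d : v.adicCompletion F) * (resL e' x 1) ^ 2 ∈
        primePowBall (v.adicCompletion F) (2 * (a + 1) - 1) := by
      have : (0 : ℤ) - -m = 2 * (a + 1) - 1 := by omega
      rwa [this] at hQ1
    obtain ⟨h0, h1⟩ := Literature.NumberTheory.QuadraticForms.mem_primePowBall_of_sq_sub_mul_sq_mem_odd hdv hnsq h2 hQ1'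
    rw [mem_piPrimePowBall_iff]
    intro i; fin_cases i
    · exact h0
    · exact h1
  -- ### (4) the partial Fourier side: `𝓕_{x′} ⊠ 1` implements the partial Weyl element
  letI : MeasurableSpace (Fin 2 → v.adicCompletion F) := borel _
  haveI : BorelSpace (Fin 2 → v.adicCompletion F) := ⟨rfl⟩
  obtain ⟨μ₁, hμ₁⟩ : ∃ μ₁ : MeasureTheory.Measure (Fin 2 → v.adicCompletion F), μ₁.IsAddHaarMeasure :=
    ⟨MeasureTheory.Measure.addHaar, inferInstance⟩
  have hwF := implements_partialWeyl_boxFourier (localGram F N T v) hAd e' hψc hψ hl hb μ₁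
  -- the Fourier-side quadratic map `Q₂ = c · Nsw`, `Nsw ξ = ξ₁² − d ξ₀²`, `c = cm · (−½)`
  let Nsw : QuadraticMap (v.adicCompletion F) (Fin 2 → v.adicCompletion F) (v.adicCompletion F) :=
    QuadraticMap.proj 1 1 - (d : v.adicCompletion F) • QuadraticMap.proj 0 0
  have hNsw : ∀ ξ : Fin 2 → v.adicCompletion F, Nsw ξ = (ξ 1) ^ 2 - (d : v.adicCompletion F) * (ξ 0) ^ 2 := by
    intro ξ
    simp only [Nsw, QuadraticMap.sub_apply, QuadraticMap.smul_apply, QuadraticMap.proj_apply, smul_eq_mul]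
    ring
  have hE2 : ∀ b ∈ primePowBall (v.adicCompletion F) 0, ∃ l : ℂ, ∀ y : Fin N → v.adicCompletion F,
      (((boxEquivSB (v.adicCompletion F) e' (piFourierEquivSB μ₁ hψc hψ)
          (LinearEquiv.refl ℂ (SchwartzBruhat ({k // ¬ pp k} → v.adicCompletion F)))).symm f' :
            SchwartzBruhat (Fin N → v.adicCompletion F)) : (Fin N → v.adicCompletion F) → ℂ) y *
          ((adeleAddCharAt F v (b * ((cm * -(⅟(2 : v.adicCompletion F))) * Nsw (resL e' y))) : Circle) : ℂ) =
        l * (((boxEquivSB (v.adicCompletion F) e' (piFourierEquivSB μ₁ hψc hψ)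
          (LinearEquiv.refl ℂ (SchwartzBruhat ({k // ¬ pp k} → v.adicCompletion F)))).symm f' :
            SchwartzBruhat (Fin N → v.adicCompletion F)) : (Fin N → v.adicCompletion F) → ℂ) y := by
    intro b hb0
    have ht : cm * b ∈ primePowBall (v.adicCompletion F) m := by
      rw [mul_mem_primePowBall_iff hcm, sub_self]; exact hb0
    obtain ⟨κ, hκ⟩ := hPf _ (hKr' _ ht)
    obtain ⟨κ₂, hκ₂⟩ := eigenvector_of_conj_weyl_unipotentSp_apply (localPairing F N T v) (adeleAddCharAt F v) hl hb hU q
      (P _) (partialWeyl (localGram F N T v) hAd e') _ hwF ((cm * b) • c₀') (symm_smul_of_symm (localPairing F N T v) c₀' hc₀' (cm * b))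
      (hqc' (cm * b)) (by rw [hqproj, hP]; exact hC2 (cm * b)) f κ hκ
    refine ⟨κ₂, fun y => ?_⟩
    have key : b * ((cm * -(⅟(2 : v.adicCompletion F))) * Nsw (resL e' y)) =
        -(⅟(2 : v.adicCompletion F) * localPairing F N T v y (((cm * b) • c₀') y)) := by
      rw [LinearMap.smul_apply, map_smul, smul_eq_mul, hQ₀', hNsw]; ring
    rw [key]
    exact hκ₂ y
  -- the lattice hypothesis (H): parity `−m + 2a = 0 + 1`
  have hc : normAbs (v.adicCompletion F) (cm * -(⅟(2 : v.adicCompletion F))) =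
      ((residueFieldCard (v.adicCompletion F) : ℝ≥0)⁻¹) ^ (-(-m)) := by
    rw [map_mul, hcm, hhalf, mul_one, neg_neg]
  have he₀ : (Pi.single 1 1 : Fin 2 → v.adicCompletion F) ∈ piPrimePowBall (v.adicCompletion F) (Fin 2) 0 := by
    rw [mem_piPrimePowBall_iff]; intro i
    rw [mem_primePowBall_iff, zpow_zero]
    by_cases hi1 : i = 1
    · subst hi1; rw [Pi.single_eq_same, map_one]
    · rw [Pi.single_eq_of_ne hi1, map_zero]; exact zero_le_one
  have hNe₀ : normAbs (v.adicCompletion F) (Nsw (Pi.single 1 1)) = 1 := by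
    rw [hNsw]; simp
  have hpar : -m + 2 * (a + 1) = 0 + 1 := by omega
  have hH := exists_mem_piPrimePowBall_mul_quadraticMap_add_sub_notMem Nsw he₀ hNe₀ hc h2 hpar
  -- ### (5) the integral uncertainty principle: `f′ = 0`, hence `f = 0`
  have hf'0 : f' = 0 :=
    eq_zero_of_resL_support_subset_box_of_boxFourier_symm_eigen e' μ₁ hψc hψ
      (fun ξ => (cm * -(⅟(2 : v.adicCompletion F))) * Nsw ξ) f' hS hE2 (by simpa using hH)
  have : (MpPsi.toOp _ q) f = 0 := hf'0
  exact (map_eq_zero_iff _ (MpPsi.toOp _ q).injective).1 this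

end Head

end Literature.NumberTheory.Automorphic.UnitaryGroup

end
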